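import Summits.BirchSwinnertonDyer.Rank1Residual.X1.MuPart
import HarnessLib

/-!
# Residual class X1 ∩ {r = 0}: granted the analytic sharpness of the Eisenstein congruence (TYPED,
# certified per census member), the class statement IS the λ-part of Mazur's main conjecture

HONEST FRAMING (cell `b2b-bsdres`, run/shared/lean/b2b/bsd-rank1-residual/, verbatim): the goal of the
cell is to DELETE the COMBINATION-SHAPED residual classes of the BSD formula for ALL analytic-rank
`≤ 1` curves over `ℚ` from PUBLISHED theorems only, and to TYPE what is not published; this is not
"finishing BSD". Sub-cell `b2b-bsdres-eisenstein-p1` (CLASS-OWNERS row "X1 (r=0)"), gen 4: research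
route; NO CLAIM BEYOND STATED CLASSES; nothing here changes a label.

Sequel of `X1/MuPart.lean` (p203756): there, at ONE leaf member, the μ-part of Mazur's main conjecture
follows from Greenberg Prop. 5.7 and the finite certificate `AnalyticMuLE W p m` (μ_an ≤ ramified-odd
cyclic depth). Here the certificate is quantified over the leaf as ONE typed hypothesis
`AnalyticMuSharpOnLeaf` — "at every leaf curve the Eisenstein-congruence depth of `L_p(E,T)` is at
most the depth of a ramified cyclic `Γ_ℚ`-stable subgroup it carries" (the analytic twin of Greenberg's
μ-conjecture; certified at 7533/7533 census members by iw-2, OPEN class-wide; nothing asserted) — and the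
sub-cell statement `RankZero.Statement` (= `BSDp` at every X1 pair of analytic rank 0) becomes
EQUIVALENT to the λ-part of Mazur's main conjecture at every leaf pair
(`statement_iff_forall_lambdaPartAt`), granted the PUBLISHED named facts already used in
`X1/MuLambda.lean` (Wuthrich Thm. 16, Greenberg Thm. 4.1, modularity, GZK) and Prop. 5.7.
So the Greenberg–Vatsal-route residue of X1 ∩ {r = 0} (HOME/b2b-bsdres-eisenstein-p1/X1R0-GAPMAP.md
§5, §11) is typed as exactly two named inputs: `AnalyticMuSharpOnLeaf` (analytic, per-pair
certifiable) and the λ-part (`LambdaPartAt`, no published tool at type A).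

References: [GreenbergLNM1716] Prop. 5.7 (PDF p. 139), Conj. 1.11; [GreenbergVatsal2000] (1)–(2), p. 4;
[Wuthrich2014] Thm. 16; HOME/b2b-bsdres-eisenstein-p1/X1R0-GAPMAP.md §11; HOME/b2b-bsdres-iw-2/IWASAWA-CENSUS.md.
-/

noncomputable section

open scoped Classical MatrixGroups ModularForm
open CongruenceSubgroup WeierstrassCurve Literature.NumberTheory.EllipticCurves
  Literature.NumberTheory.EllipticCurves.ModularForms Literature.NumberTheory.EllipticCurves.Rank1Residual
  Literature.NumberTheory.EllipticCurves.Greenberg1999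
  Summit.BirchSwinnertonDyer.BirchSwinnertonDyer.Theorems.Rank1ResidualX1Defs
  Summit.BirchSwinnertonDyer.BirchSwinnertonDyer.Theorems.Rank1ResidualX1Converse
  Summit.BirchSwinnertonDyer.Rank1Residual.X1.MuLambda
  Summit.BirchSwinnertonDyer.Rank1Residual.X1.MuStructure
  Summit.BirchSwinnertonDyer.Rank1Residual.X1.MuPart

set_option autoImplicit false

namespace Summit.BirchSwinnertonDyer.Rank1Residual.X1.LambdaResidue

/-- **Analytic sharpness of the Eisenstein congruence on the leaf (TYPED; nothing asserted).** For
every leaf pair `(E,p)` (X1 ∧ `r_an = 0`): EITHER some coefficient of the Néron-normalised `ϖ·L_p(f,α)`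
is a `p`-adic unit (`AnalyticMuLE W p 0`, "μ_an = 0" — the φ-end of the class), OR `E` carries a
`Γ_ℚ`-stable CYCLIC subgroup `Φ ≤ E(ℚ̄)` of order `p^m`, `m ≥ 1`, whose `p`-torsion line `Φ₁ ⊆ Φ` is
ramified at `p`, with `AnalyticMuLE W p m` ("μ_an ≤ m"). By `X1/MuDepth.lean` the second clause forces
`μ_an = μ_alg = m` (`MuPart.mu_eq_…`); so this is the analytic twin of Greenberg's μ-conjecture on the
leaf: "the analytic μ-invariant is the ramified-odd cyclic depth". Certified at every census member
(iw-2, IWASAWA-CENSUS part II: `μ_an = m_lb`, 7533/7533); OPEN class-wide (Bellaïche–Pollack 2019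
Thm. 1.2 is the tame-level-1 analogue). [cite: GreenbergLNM1716, Conj. 1.11 and Prop. 5.7 (shape only; nothing asserted)]
[cite: GreenbergVatsal2000, p. 2, (2) (shape only)] -/
def AnalyticMuSharpOnLeaf : Prop :=
  ∀ (W : WeierstrassCurve ℚ) [W.IsElliptic] [W.IsGloballyMinimal] (p : ℕ) [Fact p.Prime],
    RankZero.Leaf W p →
    AnalyticMuLE W p 0 ∨
    ∃ (m : ℕ) (Φ : AddSubgroup W.geomPoints) (Φ₁ : AddSubgroup (geomTorsion W (p : ℤ))),
      1 ≤ m ∧ IsAddCyclic Φ ∧ Nat.card Φ = p ^ m ∧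
      (∀ σ : Field.absoluteGaloisGroup ℚ, ∀ P ∈ Φ, σ • P ∈ Φ) ∧ IsRationalLine W p Φ₁ ∧
      (∀ P ∈ Φ₁, (P : W.geomPoints) ∈ Φ) ∧ ¬ LineUnramifiedAt W p Φ₁ ∧ AnalyticMuLE W p m

variable {W : WeierstrassCurve ℚ} [W.IsElliptic] [W.IsGloballyMinimal] {p : ℕ} [Fact p.Prime]

/-- **The μ-part at every leaf pair, granted the analytic sharpness** (Wuthrich Thm. 16 + Greenberg
Prop. 5.7 general form, PUBLISHED; `MuPart.Leaf.muPartAt_…`). [cite: GreenbergLNM1716, Prop. 5.7 (PDF p. 139)]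
[cite: Wuthrich2014, Thm. 16 (p. 397)] -/
theorem Leaf.muPartAt_of_analyticMuSharpOnLeaf (hW16 : Wuthrich2014.charIdeal_dvd_padicLFunction)
    (h57m : prop57_le_mu_of_ramified_odd_cyclic) (hAn : AnalyticMuSharpOnLeaf)
    (hL : RankZero.Leaf W p) : MuPartAt W p := by
  rcases hAn W p hL with h0 | ⟨m, Φ, Φ₁, hm, hcyc, hcard, hstab, hΦ₁, hsub, hram, han⟩
  · exact MuPart.Leaf.muPartAt_of_analyticMuLE_zero hW16 hL h0
  · exact MuPart.Leaf.muPartAt_of_ramified_cyclic_of_analyticMuLE hW16 h57m hL hm hcyc hcard hstab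
      hΦ₁ hsub hram han

/-- **On the leaf, granted the analytic sharpness: `BSD(E,p) ⟺ λ-part`** (facts: Wuthrich Thm. 16,
Prop. 5.7, Greenberg Thm. 4.1, modularity, GZK — all PUBLISHED). [cite: GreenbergVatsal2000, p. 4]
[cite: GreenbergLNM1716, Thm. 4.1 and Prop. 5.7] [cite: Wuthrich2014, Thm. 16 (p. 397)] -/
theorem Leaf.bsdp_iff_lambdaPartAt_of_analyticMuSharpOnLeaf
    (hW16 : Wuthrich2014.charIdeal_dvd_padicLFunction) (h57m : prop57_le_mu_of_ramified_odd_cyclic)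
    (hGr : greenberg_charValue_rankZero) (hmod : nonempty_modularParametrizationData)
    (hGZK : rank_eq_analyticRank_of_analyticRank_le_one) (hAn : AnalyticMuSharpOnLeaf)
    (hL : RankZero.Leaf W p) : BSDp W p ↔ LambdaPartAt W p := by
  rw [Leaf.bsdp_iff_muPart_and_lambdaPart hW16 hGr hmod hGZK hL]
  exact ⟨fun h => h.2, fun h => ⟨Leaf.muPartAt_of_analyticMuSharpOnLeaf hW16 h57m hAn hL, h⟩⟩

/-- **Mazur's main conjecture at a leaf pair ⟺ λ-part, granted the analytic sharpness** (Wuthrich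
Thm. 16 + Prop. 5.7). [cite: GreenbergVatsal2000, p. 4] [cite: Wuthrich2014, Thm. 16 (p. 397)] -/
theorem Leaf.mazurMainConjecture_iff_lambdaPartAt_of_analyticMuSharpOnLeaf
    (hW16 : Wuthrich2014.charIdeal_dvd_padicLFunction) (h57m : prop57_le_mu_of_ramified_odd_cyclic)
    (hAn : AnalyticMuSharpOnLeaf) (hL : RankZero.Leaf W p) :
    MazurMainConjecture W p ↔ LambdaPartAt W p := by
  have hX := isClassX1_of_classX1 hL.classX1
  rw [mazurMainConjecture_iff_muPart_and_lambdaPart hW16 hX.two_ne hX.hasGoodReductionAtPrime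
    hX.not_dvd_frobeniusTrace hX.not_hasIrreducibleModPGaloisRep]
  exact ⟨fun h => h.2, fun h => ⟨Leaf.muPartAt_of_analyticMuSharpOnLeaf hW16 h57m hAn hL, h⟩⟩

/-- **The sub-cell statement ⟺ the λ-part at every leaf pair, granted the analytic sharpness.**
`RankZero.Statement` (`BSDp` at every X1 pair of analytic rank `0`; @[conjecture], research target, NO
CLAIM) is EQUIVALENT — granted Wuthrich Thm. 16, Greenberg Prop. 5.7 (general form), Greenberg Thm. 4.1,
modularity and GZK (PUBLISHED named facts) and the typed analytic hypothesis `AnalyticMuSharpOnLeaf`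
(certified per census member, OPEN class-wide) — to `∀ leaf pairs, LambdaPartAt W p` (`λ_an ≤ λ_alg`).
The Greenberg–Vatsal-route residue of X1 ∩ {r = 0} is thereby typed as exactly {analytic sharpness} ∧
{λ-part}; Greenberg's algebraic μ-conjecture is not an input (it follows: `MuPart.mu_eq_…`).
[cite: GreenbergVatsal2000, p. 4] [cite: GreenbergLNM1716, Prop. 5.7 (PDF p. 139), Thm. 4.1]
[cite: Wuthrich2014, Thm. 16 (p. 397)] -/
theorem statement_iff_forall_lambdaPartAt
    (hW16 : Wuthrich2014.charIdeal_dvd_padicLFunction) (h57m : prop57_le_mu_of_ramified_odd_cyclic)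
    (hGr : greenberg_charValue_rankZero) (hmod : nonempty_modularParametrizationData)
    (hGZK : rank_eq_analyticRank_of_analyticRank_le_one) (hAn : AnalyticMuSharpOnLeaf) :
    RankZero.Statement ↔
    ∀ (W : WeierstrassCurve ℚ) [W.IsElliptic] [W.IsGloballyMinimal] (p : ℕ) [Fact p.Prime],
      RankZero.Leaf W p → LambdaPartAt W p := by
  rw [statement_iff_forall_muPart_and_lambdaPart hW16 hGr hmod hGZK]
  exact ⟨fun h W _ _ p _ hL => (h W p hL).2,
    fun h W _ _ p _ hL => ⟨Leaf.muPartAt_of_analyticMuSharpOnLeaf hW16 h57m hAn hL, h W p hL⟩⟩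

/-- **Greenberg's μ-conjecture on the leaf, as a consequence** (nothing conjectural used beyond the
typed analytic hypothesis): granted Wuthrich Thm. 16, Prop. 5.7, modularity and `AnalyticMuSharpOnLeaf`,
at every leaf pair EITHER `μ(X(E/ℚ_∞)) = 0` for all cyclotomic dual data OR `E` carries a ramified cyclic
`Γ_ℚ`-stable subgroup of order `p^m`, `m ≥ 1`, with `μ(X(E/ℚ_∞)) = m` for all cyclotomic dual data.
[cite: GreenbergLNM1716, Conj. 1.11 and Prop. 5.7 (PDF p. 139)] [cite: Wuthrich2014, Thm. 16 (p. 397)] -/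
theorem Leaf.mu_eq_zero_or_eq_depth_of_analyticMuSharpOnLeaf
    (hW16 : Wuthrich2014.charIdeal_dvd_padicLFunction) (h57m : prop57_le_mu_of_ramified_odd_cyclic)
    (hmod : nonempty_modularParametrizationData) (hAn : AnalyticMuSharpOnLeaf)
    (hL : RankZero.Leaf W p) :
    (∀ (κ : ZpExtension ℚ p) (γ : Field.absoluteGaloisGroup ℚ), κ.IsCyclotomic → κ.IsTopGenerator γ →
        IsCyclotomicVariable p γ → ∀ D : W.SelmerDualData κ γ, D.mu = 0) ∨
    ∃ (m : ℕ) (Φ : AddSubgroup W.geomPoints), 1 ≤ m ∧ IsAddCyclic Φ ∧ Nat.card Φ = p ^ m ∧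
      (∀ σ : Field.absoluteGaloisGroup ℚ, ∀ P ∈ Φ, σ • P ∈ Φ) ∧
      (∃ Φ₁ : AddSubgroup (geomTorsion W (p : ℤ)), IsRationalLine W p Φ₁ ∧
        (∀ P ∈ Φ₁, (P : W.geomPoints) ∈ Φ) ∧ ¬ LineUnramifiedAt W p Φ₁) ∧
      ∀ (κ : ZpExtension ℚ p) (γ : Field.absoluteGaloisGroup ℚ), κ.IsCyclotomic → κ.IsTopGenerator γ →
        IsCyclotomicVariable p γ → ∀ D : W.SelmerDualData κ γ, D.mu = m := by
  have hX := isClassX1_of_classX1 hL.classX1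
  rcases hAn W p hL with h0 | ⟨m, Φ, Φ₁, hm, hcyc, hcard, hstab, hΦ₁, hsub, hram, han⟩
  · exact Or.inl fun κ γ hκ hγ hγ' D => MuPart.mu_eq_zero_of_analyticMuLE_zero hW16 hmod hX.two_ne
      hX.hasGoodReductionAtPrime hX.not_dvd_frobeniusTrace hX.not_hasIrreducibleModPGaloisRep h0 hκ hγ
      hγ' D
  · exact Or.inr ⟨m, Φ, hm, hcyc, hcard, hstab, ⟨Φ₁, hΦ₁, hsub, hram⟩, fun κ γ hκ hγ hγ' D =>
      MuPart.mu_eq_of_ramified_cyclic_of_analyticMuLE hW16 h57m hmod hX.two_ne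
        hX.hasGoodReductionAtPrime hX.not_dvd_frobeniusTrace hX.not_hasIrreducibleModPGaloisRep hm hcyc
        hcard hstab hΦ₁ hsub hram (lineOdd_of_not_gvPar_of_ramified hL.not_gvPar hΦ₁ hram) han hκ hγ
        hγ' D⟩

end Summit.BirchSwinnertonDyer.Rank1Residual.X1.LambdaResidue

end
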